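import Summits.AtomisticToContinuum.Crystallization.Theorems.ChartedPlanarOrderPatternLayerTables

/-!
# ChartedPlanarOrder — integer site tables for the layering dichotomy, II (`PatternSiteTables`)

decomp-a2c lens-3 (generation 23/24; N = `Theses.ChartedPlanarOrder.ChartedZeroExcessLayered`, PS column).
Kernel-decided facts about the two-shell integer tables `fccInt ∪ fccSecondShellInt` (squared norms `2 | 4`) and
`hcpInt ∪ hcpSecondShellInt` (`18 | 36`) of `Literature.Geometry.DiscreteGeometry`, relative to a PERIOD PAIR
`(v, w)`: two distinct, non-antipodal first-shell vectors whose antipodes are also in the table (the integer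
shadows of the two in-plane periods of a clean stacked layered set).  With `crossInt v w` the integer normal:

* §1 IN-PLANE SITES: a table vector `u` with `u · (v × w) = 0` is `i v + j w` with `i, j ∈ {−1, 0, 1}`
  (`fcc_inplane_combo`, `hcp_inplane_combo`); for TRIANGULAR pairs (`v · w ≠ 0`, and always for hcp) such
  `u` is first-shell (`fcc_inplane_first_shell`, `hcp_inplane_first_shell`).
* §2 REGISTRY: `u · v ∈ {0, ±N/2, ±N}` for every table vector `u` and period vector `v`
  (`fcc_registry`, `hcp_registry`) — in-plane coordinates of every site are half-integers in the period basis.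
* §3 SQUARE pairs (`fcc`, `v · w = 0`): off-plane FIRST-shell sites have `u · v, u · w ∈ {±1}` (HOLLOW registry,
  `fcc_square_hollow`); second-shell sites have height class `u · (v × w) ∈ {0, ±4}` (`fcc_square_second_heights`),
  i.e. in-plane or straight above at two layer spacings.
* §4 TRIANGULAR pairs: second-shell sites are off-plane (`fcc_triangular_second_offplane`, `hcp_second_offplane`).

No `sorry`, no `instance` / `notation`; `[folklore]` arithmetic, kernel-decided.
-/

namespace Summit.AtomisticToContinuum.Crystallization.Theorems.ChartedPlanarOrderPatternSiteTables

open Literature.Geometry.DiscreteGeometry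
open Summit.AtomisticToContinuum.Crystallization.Theorems.ChartedPlanarOrderPatternLayerTables (crossInt)

/-! ## §1 In-plane sites are small integer combinations of the period pair -/

/-- fcc: an in-plane table vector is `i v + j w`, `i, j ∈ {−1, 0, 1}`. [folklore] -/
theorem fcc_inplane_combo : ∀ v ∈ fccInt ∪ fccSecondShellInt, ∀ w ∈ fccInt ∪ fccSecondShellInt,
    sqNormInt v = 2 → sqNormInt w = 2 → v ≠ w → v + w ≠ 0 → ∀ u ∈ fccInt ∪ fccSecondShellInt, dotInt u (crossInt v w) = 0 →
      ∃ i ∈ ({-1, 0, 1} : Finset ℤ), ∃ j ∈ ({-1, 0, 1} : Finset ℤ), u = fun k => i * v k + j * w k := by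
  decide

/-- hcp: an in-plane table vector is `i v + j w`, `i, j ∈ {−1, 0, 1}` (period pairs have antipodes in the table). [folklore] -/
theorem hcp_inplane_combo : ∀ v ∈ hcpInt ∪ hcpSecondShellInt, ∀ w ∈ hcpInt ∪ hcpSecondShellInt,
    sqNormInt v = 18 → sqNormInt w = 18 → -v ∈ hcpInt ∪ hcpSecondShellInt → -w ∈ hcpInt ∪ hcpSecondShellInt → v ≠ w → v + w ≠ 0 →
      ∀ u ∈ hcpInt ∪ hcpSecondShellInt, dotInt u (crossInt v w) = 0 →
      ∃ i ∈ ({-1, 0, 1} : Finset ℤ), ∃ j ∈ ({-1, 0, 1} : Finset ℤ), u = fun k => i * v k + j * w k := by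
  decide

/-- fcc, TRIANGULAR pair (`v · w ≠ 0`): in-plane sites are first-shell. [folklore] -/
theorem fcc_inplane_first_shell : ∀ v ∈ fccInt ∪ fccSecondShellInt, ∀ w ∈ fccInt ∪ fccSecondShellInt,
    sqNormInt v = 2 → sqNormInt w = 2 → v ≠ w → v + w ≠ 0 → dotInt v w ≠ 0 →
      ∀ u ∈ fccInt ∪ fccSecondShellInt, dotInt u (crossInt v w) = 0 → sqNormInt u = 2 := by
  decide

/-- hcp: in-plane sites are first-shell. [folklore] -/
theorem hcp_inplane_first_shell : ∀ v ∈ hcpInt ∪ hcpSecondShellInt, ∀ w ∈ hcpInt ∪ hcpSecondShellInt,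
    sqNormInt v = 18 → sqNormInt w = 18 → -v ∈ hcpInt ∪ hcpSecondShellInt → -w ∈ hcpInt ∪ hcpSecondShellInt → v ≠ w → v + w ≠ 0 →
      ∀ u ∈ hcpInt ∪ hcpSecondShellInt, dotInt u (crossInt v w) = 0 → sqNormInt u = 18 := by
  decide

/-! ## §2 Registry: in-plane coordinates are half-integers -/

/-- fcc: `u · v ∈ {0, ±1, ±2}` (`= {0, ±N/2, ±N}`, `N = 2`) for a first-shell `v`. [folklore] -/
theorem fcc_registry : ∀ v ∈ fccInt ∪ fccSecondShellInt, sqNormInt v = 2 → ∀ u ∈ fccInt ∪ fccSecondShellInt,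
    dotInt u v = 0 ∨ dotInt u v = 1 ∨ dotInt u v = -1 ∨ dotInt u v = 2 ∨ dotInt u v = -2 := by
  decide

/-- hcp: `u · v ∈ {0, ±9, ±18}` (`= {0, ±N/2, ±N}`, `N = 18`) for a first-shell `v` with antipode in the table. [folklore] -/
theorem hcp_registry : ∀ v ∈ hcpInt ∪ hcpSecondShellInt, sqNormInt v = 18 → -v ∈ hcpInt ∪ hcpSecondShellInt →
    ∀ u ∈ hcpInt ∪ hcpSecondShellInt,
    dotInt u v = 0 ∨ dotInt u v = 9 ∨ dotInt u v = -9 ∨ dotInt u v = 18 ∨ dotInt u v = -18 := by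
  decide

/-! ## §3 Square pairs -/

/-- fcc, SQUARE pair (`v · w = 0`): an off-plane first-shell site sits over a HOLLOW: `u · v, u · w ∈ {±1}` (`= ±N/2`). [folklore] -/
theorem fcc_square_hollow : ∀ v ∈ fccInt ∪ fccSecondShellInt, ∀ w ∈ fccInt ∪ fccSecondShellInt,
    sqNormInt v = 2 → sqNormInt w = 2 → v ≠ w → v + w ≠ 0 → dotInt v w = 0 →
      ∀ u ∈ fccInt ∪ fccSecondShellInt, sqNormInt u = 2 → dotInt u (crossInt v w) ≠ 0 →
        (dotInt u v = 1 ∨ dotInt u v = -1) ∧ (dotInt u w = 1 ∨ dotInt u w = -1) := by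
  decide

/-- fcc, SQUARE pair: second-shell sites have height class `∈ {0, ±4}` (in-plane, or straight above/below at two spacings). [folklore] -/
theorem fcc_square_second_heights : ∀ v ∈ fccInt ∪ fccSecondShellInt, ∀ w ∈ fccInt ∪ fccSecondShellInt,
    sqNormInt v = 2 → sqNormInt w = 2 → v ≠ w → v + w ≠ 0 → dotInt v w = 0 →
      ∀ u ∈ fccInt ∪ fccSecondShellInt, sqNormInt u = 4 →
        dotInt u (crossInt v w) = 0 ∨ dotInt u (crossInt v w) = 4 ∨ dotInt u (crossInt v w) = -4 := by
  decide

/-! ## §4 Triangular pairs: the second shell is off-plane -/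

/-- fcc, TRIANGULAR pair: second-shell sites are off-plane with first height class: `u · (v × w) ∈ {±2}`. [folklore] -/
theorem fcc_triangular_second_offplane : ∀ v ∈ fccInt ∪ fccSecondShellInt, ∀ w ∈ fccInt ∪ fccSecondShellInt,
    sqNormInt v = 2 → sqNormInt w = 2 → v ≠ w → v + w ≠ 0 → dotInt v w ≠ 0 →
      ∀ u ∈ fccInt ∪ fccSecondShellInt, sqNormInt u = 4 → dotInt u (crossInt v w) = 2 ∨ dotInt u (crossInt v w) = -2 := by
  decide

/-- hcp: second-shell sites are off-plane (`u · (v × w) ≠ 0`; with `…PatternPairGeometry.hcp_pair_heights` the class is `±54`). [folklore] -/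
theorem hcp_second_offplane : ∀ v ∈ hcpInt ∪ hcpSecondShellInt, ∀ w ∈ hcpInt ∪ hcpSecondShellInt,
    sqNormInt v = 18 → sqNormInt w = 18 → -v ∈ hcpInt ∪ hcpSecondShellInt → -w ∈ hcpInt ∪ hcpSecondShellInt → v ≠ w → v + w ≠ 0 →
      ∀ u ∈ hcpInt ∪ hcpSecondShellInt, sqNormInt u = 36 → dotInt u (crossInt v w) ≠ 0 := by
  intro v hv w hw h1 h2 h3 h4 h5 h6 u hu h36 h0
  have := hcp_inplane_first_shell v hv w hw h1 h2 h3 h4 h5 h6 u hu h0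
  omega

end Summit.AtomisticToContinuum.Crystallization.Theorems.ChartedPlanarOrderPatternSiteTables
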